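import Summits.QuantumFields.BalabanUV.Beta.FP.TorusCombNested
import Summits.QuantumFields.BalabanUV.Beta.FP.TorusGaugeCovarianceCoarse

/-!
# `BalabanUV.Beta.FP.TorusCombNestedBasis` — road «FP» for binder row D1, ROUTE T, RULING R-FP-52 (2), TID-LETTER-SPEC § B (iii) `hPW` AT THE TORUS (OWNER W-FP-17-6):
# the one-shot comb slice `P` = the BIG comb rows re-indexed `ρ₂ ⊕ ρ₁`, the generator matrix `W₀ = [tgradBlock↾Res′ | tgrad↾Res]` = (big-gradient columns re-indexed) ·
# a UNIPOTENT evaluation matrix `C`, hence `|det(P·W₀)| = 1`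

HONEST DEPENDENCY (page 1, mandatory): continuum YM on T⁴ ⇐ BetaPertH ∧ nine spine estimates (0/9 proved); BetaPertH ⇐ (D1) ∧ (D4) ∧ CAP+tail;
G-an2-4 gates asym, D1 and NE2/3/4.  HONEST FRAMING (cell contract, verbatim): «discharging `BetaPertH` makes Bałaban's UV stability UNCONDITIONAL —
a real constructive-QFT result; it is NOT the continuum limit and NOT the Clay problem.»  ABSOLUTE RULE (cell charter, verbatim): «No internally-minted
statement may enter as a cited fact. Every hypothesis is either kernel-proved in this package or a verbatim quotation of a PUBLISHED theorem with page
reference. The manuscript(s) under audit are NOT citable for their own disputed steps — they are the thing under adjudication; programme-internal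
(2001/route/tribunal) claims are never citable.»  THIS MODULE is [our object — bookkeeping] + [folklore] finite sums over `FP/TorusCombNested` (leaf-06) and gan24-leaf-05's
`FP/TorusGaugeCovarianceCoarse` (`tgradBlock`, `tgradBlock_eq_sum_tgrad_mul` — the PLAIN gradient of the block indicator, no `#B`).  No `def … : Prop`, nothing cited, 0 sorry.
«not in print; our bookkeeping».  OWNER W-FP-17-6 (journal 2026-08-21T23:56Z) located the shape: «`W₀ = (W″.submatrix id e.symm) · C` with `C = fromBlocks 1 0 E 1` UNIPOTENT … hence
`|det(P·W₀)| = |det(combRowsT ρ″ N² M · tgrad↾Res″)| · |det C| = 1`»; this file types it (fine box `fine N M′`, small blocking `N` with root `ρ`, coarse blocking `N₂` of the coarse box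
with root `ρ₂′`, big blocking `N·N₂` with root `ρ″ = N•ρ₂′ + ρ`).

CONTENT.
* §1 arithmetic of the three root offsets (`bigRoot_bounds`, `bigRoot_compat`, `fine_dvd`) and the junction **`smallRootEquivCoarseRes`**: «small-block roots of the fine box that are
  not big-block roots» ≃ `Res ρ₂′ N₂ M′` (coarse residual parameters) through `quo N` ∕ `t̄ ↦ N•t̄ + ρ`; **`resBigEquiv : Res ρ″ (N·N₂) (fine N M′) ≃ Res ρ₂′ N₂ M′ ⊕ Res ρ N (fine N M′)`**.
* §2 the evaluation matrix **`evalC := fromBlocks 1 0 E 1`**, `E s t̄ = [quo N s.site = ↑t̄]`, `det_evalC : det = 1`.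
* §3 **`W0_eq`**: `fromCols ((tgradBlock M′ N)↾Res′) ((tgrad (fine N M′))↾Res) = ((tgrad (fine N M′))↾Res″).submatrix id resBigEquiv.symm * evalC`.
* §4 **`abs_det_bigCombRows_mul_W0_eq_one`**: `|det(((combRowsT ρ″ (N·N₂) (fine N M′)).submatrix resBigEquiv.symm id) * fromCols (tgradBlock↾Res′) (tgrad↾Res))| = 1` — the OWNER's `hPW`
  with modulus `1` (`CombSliceJetLetters.det_ne_zero_of_abs_det_eq_one` for p308750's `det ≠ 0` form).
* §5 **`combRowsT_fieldSlot_mul`** (the comb rows vanish off the field slots) and the same two letters with `P`, `W₀` READ ON THE FIELD SLOTS `(s, inl α)` (OWNER W-FP-17-7 (3)),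
  also in the CALL's own shape `P * fromCols D₂ D₁` (`abs_det_bigCombRows_mul_fromCols_eq_one`, `det_bigCombRows_mul_fromCols_ne_zero`; `c' = 1`).
0 estimates; 0∕4 row-D1 binders; NOT (T-ID) complete, NOT SDF, NOT D1, NOT BetaPertH, NOT continuum, NOT Clay.
Provenance: D1 formalisation swarm LEAF PROVER 06, unit b2b-balaban-beta-d1-formalise-leaf-06 gen 16, 2026-08-22 (OWNER ASK W-FP-17-6, first refusal leaf-06; W-4∕INTENT 7).
-/

noncomputable section

namespace Summit.QuantumFields.BalabanUV.Beta.FP.TorusCombNestedBasis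

open Finset Matrix
open scoped BigOperators
open Literature.MathematicalPhysics.QuantumFieldTheory.Balaban1983to89
open Literature.MathematicalPhysics.QuantumFieldTheory.Balaban1983to89.Beta
open B5Prop11Plancherel (fine)
open AffineAveraging (Site)
open B6Lemma24Torus (pbox mem_pbox)
open Literature.MathematicalPhysics.QuantumFieldTheory.LatticeForm (quo)
open OneStepResolventKernel (Fib)
open Summit.QuantumFields.BalabanUV.Beta.FP.KernelPeriodisationFib (Idx)
open Summit.QuantumFields.BalabanUV.Beta.FP.TorusCombForest
open Summit.QuantumFields.BalabanUV.Beta.FP.TorusCombRows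
open Summit.QuantumFields.BalabanUV.Beta.FP.TorusCombNested
open Summit.QuantumFields.BalabanUV.Beta.FP.TorusGaugeCovariance (tgrad tdelta_of_mem)
open Summit.QuantumFields.BalabanUV.Beta.FP.TorusGaugeCovarianceCoarse (tgradBlock tgradBlock_eq_sum_tgrad_mul)

variable {d : ℕ}

/-! ## §1 The three root offsets; the junction with the coarse residual parameters -/

section Roots

variable {N N₂ : ℕ} {ρ ρ₂ : Site (d + 1)} {M' : Fin (d + 1) → ℕ}

/-- [folklore] the big root offset `ρ″ = N•ρ₂′ + ρ` lies in the big block `[0, N·N₂)`. -/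
theorem bigRoot_bounds (hN : 0 < N) (hρ : ∀ i, 0 ≤ ρ i ∧ ρ i < N) (hρ₂ : ∀ i, 0 ≤ ρ₂ i ∧ ρ₂ i < N₂) (i : Fin (d + 1)) :
    0 ≤ ((N : ℤ) • ρ₂ + ρ) i ∧ ((N : ℤ) • ρ₂ + ρ) i < ((N * N₂ : ℕ) : ℤ) := by
  have h1 := hρ i; have h2 := hρ₂ i
  have hN' : (0 : ℤ) < N := by exact_mod_cast hN
  simp only [Pi.add_apply, Pi.smul_apply, smul_eq_mul, Nat.cast_mul]
  constructor
  · nlinarith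
  · nlinarith

/-- [folklore] the big and small root offsets are compatible modulo `N`. -/
theorem bigRoot_compat (i : Fin (d + 1)) : (N : ℤ) ∣ ((N : ℤ) • ρ₂ + ρ) i - ρ i :=
  ⟨ρ₂ i, by simp only [Pi.add_apply, Pi.smul_apply, smul_eq_mul]; ring⟩

/-- [folklore] `N·N₂ ∣ (fine N M′) i` when `N₂ ∣ M′ i`. -/
theorem fine_dvd (hM' : ∀ i, N₂ ∣ M' i) (i : Fin (d + 1)) : N * N₂ ∣ fine N M' i := by
  obtain ⟨c, hc⟩ := hM' i
  exact ⟨c, by simp only [fine, hc]; ring⟩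

/-- [folklore] `N ∣ (fine N M′) i`. -/
theorem fine_dvd_small (i : Fin (d + 1)) : N ∣ fine N M' i := ⟨M' i, rfl⟩

/-- [folklore] a fine-box point has its block index in the coarse box. -/
theorem quo_mem_pbox (hN : 0 < N) {s : Site (d + 1)} (hs : s ∈ pbox (fine N M')) : quo N s ∈ pbox M' := by
  rw [mem_pbox] at hs ⊢
  intro i
  have hN' : (0 : ℤ) < N := by exact_mod_cast hN
  have h := hs i
  simp only [fine, Nat.cast_mul] at h
  refine ⟨Int.ediv_nonneg h.1 hN'.le, ?_⟩
  show s i / (N : ℤ) < (M' i : ℤ)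
  rw [Int.ediv_lt_iff_lt_mul hN']
  linarith [h.2]

/-- [folklore] a coarse-box point lifted to its small root lies in the fine box. -/
theorem lift_mem_pbox (hN : 0 < N) (hρ : ∀ i, 0 ≤ ρ i ∧ ρ i < N) {t : Site (d + 1)} (ht : t ∈ pbox M') : (N : ℤ) • t + ρ ∈ pbox (fine N M') := by
  rw [mem_pbox] at ht ⊢
  intro i
  have hN' : (0 : ℤ) < N := by exact_mod_cast hN
  have h := ht i; have hr := hρ i
  simp only [Pi.add_apply, Pi.smul_apply, smul_eq_mul, fine, Nat.cast_mul]
  constructor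
  · nlinarith
  · nlinarith

/-- [folklore] the block index of the lifted point is the point. -/
theorem quo_lift (hN : 0 < N) (hρ : ∀ i, 0 ≤ ρ i ∧ ρ i < N) (t : Site (d + 1)) : quo N ((N : ℤ) • t + ρ) = t := by
  funext i
  show ((N : ℤ) • t + ρ) i / (N : ℤ) = t i
  simp only [Pi.add_apply, Pi.smul_apply, smul_eq_mul]
  exact ediv_eq_of_bounds hN (by linarith [(hρ i).1]) (by linarith [(hρ i).2])

/-- [folklore] a small root IS the lift of its block index. -/
theorem lift_quo_of_root {s : Site (d + 1)} (hs : s = rootOf ρ N s) : (N : ℤ) • quo N s + ρ = s := by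
  conv_rhs => rw [hs]
  funext i
  simp only [Pi.add_apply, Pi.smul_apply, smul_eq_mul, rootOf]
  rfl

/-- [folklore] the lift of a coarse point is a small root. -/
theorem lift_eq_rootOf (hN : 0 < N) (hρ : ∀ i, 0 ≤ ρ i ∧ ρ i < N) (t : Site (d + 1)) :
    (N : ℤ) • t + ρ = rootOf ρ N ((N : ℤ) • t + ρ) := by
  have hq := quo_lift hN hρ t
  funext i
  have hqi := congrFun hq i
  simp only [rootOf]
  show ((N : ℤ) • t + ρ) i = (N : ℤ) * (((N : ℤ) • t + ρ) i / (N : ℤ)) + ρ i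
  rw [show ((N : ℤ) • t + ρ) i / (N : ℤ) = quo N ((N : ℤ) • t + ρ) i from rfl, hqi]
  simp only [Pi.add_apply, Pi.smul_apply, smul_eq_mul]

/-- [folklore] **FOR A SMALL ROOT, «BIG ROOT» READS ON THE BLOCK INDEX**: `s = rootOf ρ″ (N·N₂) s ↔ quo N s = rootOf ρ₂′ N₂ (quo N s)`. -/
theorem eq_bigRoot_iff_quo (hN : 0 < N) (hρ : ∀ i, 0 ≤ ρ i ∧ ρ i < N) (hN₂ : 0 < N₂) (hρ₂ : ∀ i, 0 ≤ ρ₂ i ∧ ρ₂ i < N₂) {s : Site (d + 1)}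
    (hs : s = rootOf ρ N s) : s = rootOf ((N : ℤ) • ρ₂ + ρ) (N * N₂) s ↔ quo N s = rootOf ρ₂ N₂ (quo N s) := by
  rw [eq_rootOf_iff_dvd (Nat.mul_pos hN hN₂) (bigRoot_bounds hN hρ hρ₂), eq_rootOf_iff_dvd hN₂ hρ₂]
  have hs' := lift_quo_of_root (ρ := ρ) (N := N) hs
  have hN0 : (N : ℤ) ≠ 0 := by exact_mod_cast hN.ne'
  constructor
  · intro h i
    obtain ⟨k, hk⟩ := h i
    have e : s i = (N : ℤ) * quo N s i + ρ i := by
      have := congrFun hs' i; simp only [Pi.add_apply, Pi.smul_apply, smul_eq_mul] at this; linarith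
    refine ⟨k, ?_⟩
    have : (N : ℤ) * (quo N s i - ρ₂ i) = (N : ℤ) * ((N₂ : ℤ) * k) := by
      rw [mul_sub]; simp only [Pi.add_apply, Pi.smul_apply, smul_eq_mul, Nat.cast_mul] at hk; linarith
    exact mul_left_cancel₀ hN0 this
  · intro h i
    obtain ⟨k, hk⟩ := h i
    have e : s i = (N : ℤ) * quo N s i + ρ i := by
      have := congrFun hs' i; simp only [Pi.add_apply, Pi.smul_apply, smul_eq_mul] at this; linarith
    refine ⟨k, ?_⟩
    simp only [Pi.add_apply, Pi.smul_apply, smul_eq_mul, Nat.cast_mul]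
    rw [e]; linear_combination (N : ℤ) * hk

variable (N N₂ ρ ρ₂ M')

/-- [our object — bookkeeping] **SMALL ROOTS THAT ARE NOT BIG ROOTS ≃ THE COARSE RESIDUAL PARAMETERS** (through the block index `quo N` ∕ the lift `t̄ ↦ N•t̄ + ρ`). -/
def smallRootEquivCoarseRes (hN : 0 < N) (hρ : ∀ i, 0 ≤ ρ i ∧ ρ i < N) (hN₂ : 0 < N₂) (hρ₂ : ∀ i, 0 ≤ ρ₂ i ∧ ρ₂ i < N₂) :
    {s : Res ((N : ℤ) • ρ₂ + ρ) (N * N₂) (fine N M') // s.site = rootOf ρ N s.site} ≃ Res ρ₂ N₂ M' where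
  toFun s := ⟨⟨quo N s.1.site, quo_mem_pbox hN s.1.mem⟩, fun h => s.1.not_root ((eq_bigRoot_iff_quo hN hρ hN₂ hρ₂ s.2).2 h)⟩
  invFun t := ⟨⟨⟨(N : ℤ) • t.site + ρ, lift_mem_pbox hN hρ t.mem⟩,
      fun h => t.not_root (by
        have h' := (eq_bigRoot_iff_quo hN hρ hN₂ hρ₂ (lift_eq_rootOf hN hρ t.site)).1 h
        rwa [quo_lift hN hρ] at h')⟩, lift_eq_rootOf hN hρ t.site⟩
  left_inv s := by
    apply Subtype.ext; apply Subtype.ext; apply Subtype.ext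
    exact lift_quo_of_root s.2
  right_inv t := by
    apply Subtype.ext; apply Subtype.ext
    exact quo_lift hN hρ t.site

/-- [our object — bookkeeping] **THE `ρ₂ ⊕ ρ₁` PRESENTATION OF THE BIG RESIDUAL PARAMETERS**: `Res ρ″ (N·N₂) (fine N M′) ≃ Res ρ₂′ N₂ M′ ⊕ Res ρ N (fine N M′)`. -/
def resBigEquiv (hN : 0 < N) (hρ : ∀ i, 0 ≤ ρ i ∧ ρ i < N) (hN₂ : 0 < N₂) (hρ₂ : ∀ i, 0 ≤ ρ₂ i ∧ ρ₂ i < N₂) :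
    Res ((N : ℤ) • ρ₂ + ρ) (N * N₂) (fine N M') ≃ Res ρ₂ N₂ M' ⊕ Res ρ N (fine N M') :=
  (resNestedEquiv hN hρ (Nat.mul_pos hN hN₂) (bigRoot_bounds hN hρ hρ₂) (Dvd.intro N₂ rfl) bigRoot_compat).trans
    (Equiv.sumCongr (smallRootEquivCoarseRes N N₂ ρ ρ₂ M' hN hρ hN₂ hρ₂) (Equiv.refl _))

variable {N N₂ ρ ρ₂ M'}

/-- [folklore] the site of `resBigEquiv.symm (inr s)` is `s.site`. -/
theorem resBigEquiv_symm_inr_site (hN : 0 < N) (hρ : ∀ i, 0 ≤ ρ i ∧ ρ i < N) (hN₂ : 0 < N₂) (hρ₂ : ∀ i, 0 ≤ ρ₂ i ∧ ρ₂ i < N₂)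
    (s : Res ρ N (fine N M')) : ((resBigEquiv N N₂ ρ ρ₂ M' hN hρ hN₂ hρ₂).symm (Sum.inr s)).site = s.site := rfl

/-- [folklore] the site of `resBigEquiv.symm (inl t̄)` is the small root `N•t̄ + ρ`. -/
theorem resBigEquiv_symm_inl_site (hN : 0 < N) (hρ : ∀ i, 0 ≤ ρ i ∧ ρ i < N) (hN₂ : 0 < N₂) (hρ₂ : ∀ i, 0 ≤ ρ₂ i ∧ ρ₂ i < N₂)
    (t : Res ρ₂ N₂ M') : ((resBigEquiv N N₂ ρ ρ₂ M' hN hρ hN₂ hρ₂).symm (Sum.inl t)).site = (N : ℤ) • t.site + ρ := rfl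

end Roots

/-! ## §2 The unipotent evaluation matrix -/

section Eval

variable (N N₂ : ℕ) (ρ ρ₂ : Site (d + 1)) (M' : Fin (d + 1) → ℕ)

open Classical in
/-- [our object — bookkeeping] **THE INCIDENCE BLOCK** `E s t̄ = [the N-block of s has index t̄]`. -/
def evalE : Matrix (Res ρ N (fine N M')) (Res ρ₂ N₂ M') ℝ := fun s t => if quo N s.site = t.site then 1 else 0

/-- [our object — bookkeeping] **THE UNIPOTENT EVALUATION MATRIX** `C = fromBlocks 1 0 E 1` («evaluate the mode at the big-block non-root sites»). -/
def evalC : Matrix (Res ρ₂ N₂ M' ⊕ Res ρ N (fine N M')) (Res ρ₂ N₂ M' ⊕ Res ρ N (fine N M')) ℝ :=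
  Matrix.fromBlocks 1 0 (evalE N N₂ ρ ρ₂ M') 1

/-- [folklore] `det C = 1`. -/
theorem det_evalC : (evalC N N₂ ρ ρ₂ M').det = 1 := by
  rw [evalC, Matrix.det_fromBlocks_zero₁₂, Matrix.det_one, Matrix.det_one, mul_one]

end Eval

/-! ## §3 The generator matrix in the `ρ₂ ⊕ ρ₁` basis -/

section Basis

variable {N N₂ : ℕ} {ρ ρ₂ : Site (d + 1)} {M' : Fin (d + 1) → ℕ} [∀ μ, NeZero (M' μ)] [NeZero N]

/-- [folklore] **THE BLOCK-CONSTANT COLUMN SPLITS OVER THE BLOCK's SMALL ROOT AND ITS SMALL NON-ROOTS**: for a coarse residual parameter `t̄`,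
`tgradBlock M′ N q ↑t̄ = tgrad (fine N M′) q (N•t̄ + ρ) + Σ_{s ∈ Res ρ N} [quo N s = t̄] · tgrad (fine N M′) q s`. -/
theorem tgradBlock_split (hN : 0 < N) (hρ : ∀ i, 0 ≤ ρ i ∧ ρ i < N) (q : Idx (fine N M') (Fib d)) (t : Res ρ₂ N₂ M') :
    tgradBlock M' N q t.1 = tgrad (fine N M') q ⟨(N : ℤ) • t.site + ρ, lift_mem_pbox hN hρ t.mem⟩
      + ∑ s : Res ρ N (fine N M'), evalE N N₂ ρ ρ₂ M' s t * tgrad (fine N M') q s.1 := by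
  rw [tgradBlock_eq_sum_tgrad_mul]
  -- split the sum over the fine box into small roots and small non-roots
  rw [← Fintype.sum_subtype_add_sum_subtype (fun s : ↥(pbox (fine N M')) => (s : Site (d + 1)) ≠ rootOf ρ N s)
    (fun s => tgrad (fine N M') q s * TorusGaugeCovariance.tdelta M' (quo N (s : Site (d + 1))) t.1)]
  rw [add_comm]
  congr 1
  · -- the small roots: exactly one of them has block index `t̄`
    rw [Finset.sum_eq_single (⟨⟨(N : ℤ) • t.site + ρ, lift_mem_pbox hN hρ t.mem⟩, fun h => h (lift_eq_rootOf hN hρ t.site)⟩ :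
      {s : ↥(pbox (fine N M')) // ¬ (s : Site (d + 1)) ≠ rootOf ρ N s})]
    · show tgrad (fine N M') q _ * TorusGaugeCovariance.tdelta M' (quo N ((N : ℤ) • t.site + ρ)) t.1 = _
      rw [quo_lift hN hρ, tdelta_of_mem M' t.mem t.1, if_pos rfl, mul_one]
    · intro s _ hs
      have hroot : (s.1 : Site (d + 1)) = rootOf ρ N s.1 := not_not.1 s.2
      rw [tdelta_of_mem M' (quo_mem_pbox hN s.1.2) t.1, if_neg, mul_zero]
      intro hq
      apply hs
      apply Subtype.ext; apply Subtype.ext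
      show (s.1 : Site (d + 1)) = (N : ℤ) • t.site + ρ
      rw [← lift_quo_of_root hroot, hq]
    · intro h; exact absurd (Finset.mem_univ _) h
  · -- the small non-roots = `Res ρ N (fine N M')`
    refine Finset.sum_congr rfl fun s _ => ?_
    rw [tdelta_of_mem M' (quo_mem_pbox hN s.1.2) t.1, mul_comm]
    rfl

/-- [folklore] re-indexing a product on both outer indices (`id` in the middle). -/
theorem submatrix_mul_submatrix {l m o : Type*} [Fintype m] (P : Matrix l m ℝ) (T : Matrix m l ℝ) (e : o → l) :
    P.submatrix e id * T.submatrix id e = (P * T).submatrix e e := by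
  ext i j
  rfl

/-- [folklore] **`W₀` IN THE `ρ₂ ⊕ ρ₁` BASIS**: `[tgradBlock↾Res′ | tgrad↾Res] = (tgrad↾Res″ re-indexed by resBigEquiv) · C`. -/
theorem W0_eq (hN : 0 < N) (hρ : ∀ i, 0 ≤ ρ i ∧ ρ i < N) (hN₂ : 0 < N₂) (hρ₂ : ∀ i, 0 ≤ ρ₂ i ∧ ρ₂ i < N₂) :
    Matrix.fromCols ((tgradBlock M' N).submatrix id fun t : Res ρ₂ N₂ M' => t.1)
        ((tgrad (fine N M')).submatrix id fun s : Res ρ N (fine N M') => s.1)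
      = ((tgrad (fine N M')).submatrix id fun s : Res ((N : ℤ) • ρ₂ + ρ) (N * N₂) (fine N M') => s.1).submatrix id
          (resBigEquiv N N₂ ρ ρ₂ M' hN hρ hN₂ hρ₂).symm * evalC N N₂ ρ ρ₂ M' := by
  ext q c
  rw [Matrix.mul_apply, Fintype.sum_sum_type]
  rcases c with t | s
  · -- block column
    simp only [Matrix.fromCols_apply_inl, Matrix.submatrix_apply, id_eq, evalC, Matrix.fromBlocks_apply₁₁, Matrix.fromBlocks_apply₂₁,
      Matrix.one_apply, mul_ite, mul_one, mul_zero, Finset.sum_ite_eq', Finset.mem_univ, if_true]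
    rw [tgradBlock_split hN hρ q t]
    congr 1
    exact Finset.sum_congr rfl fun s _ => by rw [mul_comm]; rfl
  · -- fine residual column
    simp only [Matrix.fromCols_apply_inr, Matrix.submatrix_apply, id_eq, evalC, Matrix.fromBlocks_apply₁₂, Matrix.fromBlocks_apply₂₂,
      Matrix.zero_apply, mul_zero, Finset.sum_const_zero, zero_add, Matrix.one_apply, mul_ite, mul_one, Finset.sum_ite_eq', Finset.mem_univ, if_true]
    rfl

/-- [folklore] **THE OWNER's `hPW` AT THE TORUS, MODULUS ONE**: with `P` the BIG comb rows re-indexed by `resBigEquiv` and `W₀ = [tgradBlock↾Res′ | tgrad↾Res]`,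
`|det(P·W₀)| = 1` — `TorusCombRows.abs_det_combRowsT_mul_tgrad_eq_one` at the big blocking, `W0_eq`, `det_evalC`. -/
theorem abs_det_bigCombRows_mul_W0_eq_one (hN : 0 < N) (hρ : ∀ i, 0 ≤ ρ i ∧ ρ i < N) (hN₂ : 0 < N₂) (hρ₂ : ∀ i, 0 ≤ ρ₂ i ∧ ρ₂ i < N₂)
    (hM' : ∀ i, N₂ ∣ M' i) :
    |(((combRowsT ((N : ℤ) • ρ₂ + ρ) (N * N₂) (fine N M')).submatrix (resBigEquiv N N₂ ρ ρ₂ M' hN hρ hN₂ hρ₂).symm id)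
        * Matrix.fromCols ((tgradBlock M' N).submatrix id fun t : Res ρ₂ N₂ M' => t.1)
            ((tgrad (fine N M')).submatrix id fun s : Res ρ N (fine N M') => s.1)).det| = 1 := by
  rw [W0_eq hN hρ hN₂ hρ₂, ← Matrix.mul_assoc, Matrix.det_mul, det_evalC, mul_one, submatrix_mul_submatrix,
    Matrix.det_submatrix_equiv_self]
  exact abs_det_combRowsT_mul_tgrad_eq_one (Nat.mul_pos hN hN₂) (bigRoot_bounds hN hρ hρ₂) (fine_dvd hM')

/-- [folklore] **`hPW` AS PRINTED IN TID-LETTER-SPEC § B (iii)**: `det(P·W₀) ≠ 0`. -/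
theorem det_bigCombRows_mul_W0_ne_zero (hN : 0 < N) (hρ : ∀ i, 0 ≤ ρ i ∧ ρ i < N) (hN₂ : 0 < N₂) (hρ₂ : ∀ i, 0 ≤ ρ₂ i ∧ ρ₂ i < N₂)
    (hM' : ∀ i, N₂ ∣ M' i) :
    (((combRowsT ((N : ℤ) • ρ₂ + ρ) (N * N₂) (fine N M')).submatrix (resBigEquiv N N₂ ρ ρ₂ M' hN hρ hN₂ hρ₂).symm id)
        * Matrix.fromCols ((tgradBlock M' N).submatrix id fun t : Res ρ₂ N₂ M' => t.1)
            ((tgrad (fine N M')).submatrix id fun s : Res ρ N (fine N M') => s.1)).det ≠ 0 := by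
  intro h
  have h1 := abs_det_bigCombRows_mul_W0_eq_one hN hρ hN₂ hρ₂ hM'
  rw [h, abs_zero] at h1
  exact zero_ne_one h1

end Basis

/-! ## §5 Reading on the field slots (the instance's `P := (combRowsT ρ″ K M).submatrix e.symm fieldSlot`, OWNER W-FP-17-7 (3)) -/

section FieldSlots

variable {N : ℕ} {ρ : Site (d + 1)} {M : Fin (d + 1) → ℕ}

/-- [folklore] **THE COMB ROWS VANISH OFF THE FIELD SLOTS**: reading the rows AND the generators on the field slots `(s, inl α)` loses nothing in the product. -/
theorem combRowsT_fieldSlot_mul (hN : 0 < N) (hρ : ∀ i, 0 ≤ ρ i ∧ ρ i < N) (hM : ∀ i, N ∣ M i) {o κ : Type*} (r : o → Res ρ N M)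
    (W : Matrix (Idx M (Fib d)) κ ℝ) :
    (combRowsT ρ N M).submatrix r (fun b : ↥(pbox M) × Fin (d + 1) => ((b.1, Sum.inl b.2) : Idx M (Fib d)))
        * W.submatrix (fun b : ↥(pbox M) × Fin (d + 1) => ((b.1, Sum.inl b.2) : Idx M (Fib d))) id
      = (combRowsT ρ N M).submatrix r id * W := by
  ext x c
  have hR : ((combRowsT ρ N M).submatrix r id * W) x c = (combRowsT ρ N M * W) (r x) c := rfl
  rw [hR, combRowsT_mul_apply, Matrix.mul_apply]
  have key := combBondT_eq hN hρ hM (r x)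
  rw [Finset.sum_eq_single (⟨baseOf ρ N (r x).site, baseOf_mem_pbox hN hρ hM (r x)⟩, axisOf ρ N (r x).site)]
  · simp only [Matrix.submatrix_apply, id_eq, combRowsT]
    rw [if_pos key.symm, one_mul, key]
  · intro b _ hb
    simp only [Matrix.submatrix_apply, id_eq, combRowsT]
    rw [if_neg, zero_mul]
    intro e
    apply hb
    rw [key, Prod.mk.injEq, Sum.inl.injEq] at e
    exact Prod.ext e.1 e.2
  · intro h; exact absurd (Finset.mem_univ _) h

variable {N₂ : ℕ} {ρ₂ : Site (d + 1)} {M' : Fin (d + 1) → ℕ} [∀ μ, NeZero (M' μ)] [NeZero N]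

/-- [folklore] **`|det(P·W₀)| = 1` WITH `P` AND `W₀` READ ON THE FIELD SLOTS** (the instance's typing). -/
theorem abs_det_bigCombRows_fieldSlot_mul_W0_eq_one (hN : 0 < N) (hρ : ∀ i, 0 ≤ ρ i ∧ ρ i < N) (hN₂ : 0 < N₂)
    (hρ₂ : ∀ i, 0 ≤ ρ₂ i ∧ ρ₂ i < N₂) (hM' : ∀ i, N₂ ∣ M' i) :
    |(((combRowsT ((N : ℤ) • ρ₂ + ρ) (N * N₂) (fine N M')).submatrix (resBigEquiv N N₂ ρ ρ₂ M' hN hρ hN₂ hρ₂).symm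
          (fun b : ↥(pbox (fine N M')) × Fin (d + 1) => ((b.1, Sum.inl b.2) : Idx (fine N M') (Fib d))))
        * (Matrix.fromCols ((tgradBlock M' N).submatrix id fun t : Res ρ₂ N₂ M' => t.1)
            ((tgrad (fine N M')).submatrix id fun s : Res ρ N (fine N M') => s.1)).submatrix
            (fun b : ↥(pbox (fine N M')) × Fin (d + 1) => ((b.1, Sum.inl b.2) : Idx (fine N M') (Fib d))) id).det| = 1 := by
  rw [combRowsT_fieldSlot_mul (Nat.mul_pos hN hN₂) (bigRoot_bounds hN hρ hρ₂) (fine_dvd hM')]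
  exact abs_det_bigCombRows_mul_W0_eq_one hN hρ hN₂ hρ₂ hM'

/-- [folklore] **`hPW` AS PRINTED, ON THE FIELD SLOTS**: `det(P·W₀) ≠ 0`. -/
theorem det_bigCombRows_fieldSlot_mul_W0_ne_zero (hN : 0 < N) (hρ : ∀ i, 0 ≤ ρ i ∧ ρ i < N) (hN₂ : 0 < N₂)
    (hρ₂ : ∀ i, 0 ≤ ρ₂ i ∧ ρ₂ i < N₂) (hM' : ∀ i, N₂ ∣ M' i) :
    (((combRowsT ((N : ℤ) • ρ₂ + ρ) (N * N₂) (fine N M')).submatrix (resBigEquiv N N₂ ρ ρ₂ M' hN hρ hN₂ hρ₂).symm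
          (fun b : ↥(pbox (fine N M')) × Fin (d + 1) => ((b.1, Sum.inl b.2) : Idx (fine N M') (Fib d))))
        * (Matrix.fromCols ((tgradBlock M' N).submatrix id fun t : Res ρ₂ N₂ M' => t.1)
            ((tgrad (fine N M')).submatrix id fun s : Res ρ N (fine N M') => s.1)).submatrix
            (fun b : ↥(pbox (fine N M')) × Fin (d + 1) => ((b.1, Sum.inl b.2) : Idx (fine N M') (Fib d))) id).det ≠ 0 := by
  intro h
  have h1 := abs_det_bigCombRows_fieldSlot_mul_W0_eq_one hN hρ hN₂ hρ₂ hM'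
  rw [h, abs_zero] at h1
  exact zero_ne_one h1

/-- [folklore] `fromCols` commutes with reading the rows on the field slots (definitional re-indexing). -/
theorem fromCols_submatrix_fieldSlot {o₁ o₂ : Type*} (A : Matrix (Idx M (Fib d)) o₁ ℝ) (B : Matrix (Idx M (Fib d)) o₂ ℝ) :
    Matrix.fromCols (A.submatrix (fun b : ↥(pbox M) × Fin (d + 1) => ((b.1, Sum.inl b.2) : Idx M (Fib d))) id)
        (B.submatrix (fun b : ↥(pbox M) × Fin (d + 1) => ((b.1, Sum.inl b.2) : Idx M (Fib d))) id)
      = (Matrix.fromCols A B).submatrix (fun b : ↥(pbox M) × Fin (d + 1) => ((b.1, Sum.inl b.2) : Idx M (Fib d))) id := by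
  ext b c
  rcases c with c | c <;> rfl

/-- [folklore] **THE LETTER IN THE CALL's OWN SHAPE** (`NestedStepLawOneShotLetters.…_of_letters_static`, binder `hcP : |det(P * fromCols D₂ D₁)| = c'`
with `c' = 1`): `P := (combRowsT ρ″ (N·N₂) (fine N M′)).submatrix resBigEquiv.symm fieldSlot`, `D₂ := tgradBlock M′ N` read (field slots × `Res ρ₂ N₂ M′`),
`D₁ := tgrad (fine N M′)` read (field slots × `Res ρ N (fine N M′)`). -/
theorem abs_det_bigCombRows_mul_fromCols_eq_one (hN : 0 < N) (hρ : ∀ i, 0 ≤ ρ i ∧ ρ i < N) (hN₂ : 0 < N₂)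
    (hρ₂ : ∀ i, 0 ≤ ρ₂ i ∧ ρ₂ i < N₂) (hM' : ∀ i, N₂ ∣ M' i) :
    |(((combRowsT ((N : ℤ) • ρ₂ + ρ) (N * N₂) (fine N M')).submatrix (resBigEquiv N N₂ ρ ρ₂ M' hN hρ hN₂ hρ₂).symm
          (fun b : ↥(pbox (fine N M')) × Fin (d + 1) => ((b.1, Sum.inl b.2) : Idx (fine N M') (Fib d))))
        * Matrix.fromCols
            ((tgradBlock M' N).submatrix (fun b : ↥(pbox (fine N M')) × Fin (d + 1) => ((b.1, Sum.inl b.2) : Idx (fine N M') (Fib d)))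
              fun t : Res ρ₂ N₂ M' => t.1)
            ((tgrad (fine N M')).submatrix (fun b : ↥(pbox (fine N M')) × Fin (d + 1) => ((b.1, Sum.inl b.2) : Idx (fine N M') (Fib d)))
              fun s : Res ρ N (fine N M') => s.1)).det| = 1 := by
  have h := abs_det_bigCombRows_fieldSlot_mul_W0_eq_one hN hρ hN₂ hρ₂ hM'
  rw [← fromCols_submatrix_fieldSlot] at h
  exact h

/-- [folklore] and its `det ≠ 0` form (`hPW` of `…_of_letters_forest` ∕ `_haar`, `NestedStepLawOneShotJets.…_jets_of_uni`). -/
theorem det_bigCombRows_mul_fromCols_ne_zero (hN : 0 < N) (hρ : ∀ i, 0 ≤ ρ i ∧ ρ i < N) (hN₂ : 0 < N₂)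
    (hρ₂ : ∀ i, 0 ≤ ρ₂ i ∧ ρ₂ i < N₂) (hM' : ∀ i, N₂ ∣ M' i) :
    (((combRowsT ((N : ℤ) • ρ₂ + ρ) (N * N₂) (fine N M')).submatrix (resBigEquiv N N₂ ρ ρ₂ M' hN hρ hN₂ hρ₂).symm
          (fun b : ↥(pbox (fine N M')) × Fin (d + 1) => ((b.1, Sum.inl b.2) : Idx (fine N M') (Fib d))))
        * Matrix.fromCols
            ((tgradBlock M' N).submatrix (fun b : ↥(pbox (fine N M')) × Fin (d + 1) => ((b.1, Sum.inl b.2) : Idx (fine N M') (Fib d)))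
              fun t : Res ρ₂ N₂ M' => t.1)
            ((tgrad (fine N M')).submatrix (fun b : ↥(pbox (fine N M')) × Fin (d + 1) => ((b.1, Sum.inl b.2) : Idx (fine N M') (Fib d)))
              fun s : Res ρ N (fine N M') => s.1)).det ≠ 0 := by
  intro h0
  have h1 := abs_det_bigCombRows_mul_fromCols_eq_one hN hρ hN₂ hρ₂ hM'
  rw [h0, abs_zero] at h1
  exact zero_ne_one h1

end FieldSlots

end Summit.QuantumFields.BalabanUV.Beta.FP.TorusCombNestedBasis

end
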